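import Summits.CriticalPhenomena.PercolationContinuityZ3.Theorems.PercEventualDensityMassPropagationDroplet
import Summits.CriticalPhenomena.PercolationContinuityZ3.Theorems.PercAnnulusCrossingIICRootedCylinders
import Literature.Probability.Percolation.BernoulliPercolation
import Mathlib.Analysis.SpecificLimits.Basic
import HarnessLib

/-!
# `PercEventualDensity.MassPropagation` (stmt-CriticalPhenomena-17922) PROVED — mass propagation at one vertex (DERST §7)

RSW3 lane (lead, gen 29).  Item `stmt-CriticalPhenomena-17922` of route `CriticalPhenomena/PercEventualDensity` (support,
'provable now'): for every `p`, if the droplet bound holds at `p`, then for every `t > 0` there are `t₁ ∈ (0, t]`, `c > 0`, `N₀`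
with `P_p(|C^N(0)| ≥ t|B_N| but not |C^m(0)| ≥ t₁|B_m| for all m ≥ N) ≤ exp(−cN²)` for `N ≥ N₀`.

Proof: the first failure `m + 1 > N` of the density is preceded by a success at `m`, i.e. the event lies in `⋃_{m ≥ N} Bad_m`;
by part I (the droplet step, finite energy) and the droplet bound with `A = 2(324L + 2)`, `L = −log(1−p)`, `δ = t₁/2`,
`t₁ = min(t, 2δ₀(A))`: `P_p(Bad_m) ≤ e^{324 t₁ L (m+1)²} e^{−(324L+2) t₁ (m+1)²} = e^{−2t₁(m+1)²}`, and the tail sum is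
`≤ e^{−(t₁/2) N²}` for large `N`.  At `p = 1` every `Bad_m` is null (all edges of `B_{m+1}` are open a.s. and boxes are
connected).  No definitions, no sorries.

References: B. Diskin et al. (2026), §7 [DiskinEtAl2026]; G. Grimmett, *Percolation* (1999), §7.2 [Grimmett1999].
-/

noncomputable section

namespace Summit.CriticalPhenomena.PercolationContinuityZ3.Theorems

namespace MassPropagation

open MeasureTheory Literature.Probability.Percolation Literature.Probability.LatticeModels
open scoped Classical

/-- **First failure**: if the density is `≥ t ≥ t₁` at scale `N` but fails at some `m ≥ N`, then some `m ≥ N` is bad (density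
`≥ t₁` at `m`, `< t₁` at `m + 1`). [cite: DiskinEtAl2026, §7] -/
theorem bad_cover {t t₁ : ℝ} (ht : t₁ ≤ t) {N : ℕ} {ω : BondConfig (Site 3)}
    (hN : t * ((box 3 N).card : ℝ) ≤ ((((box 3 N).filter fun v => ω ∈ openConnIn (↑(box 3 N) : Set (Site 3)) 0 v).card : ℕ) : ℝ))
    (hfail : ¬ ∀ m : ℕ, N ≤ m → t₁ * ((box 3 m).card : ℝ) ≤
      ((((box 3 m).filter fun v => ω ∈ openConnIn (↑(box 3 m) : Set (Site 3)) 0 v).card : ℕ) : ℝ)) :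
    ∃ m : ℕ, N ≤ m ∧
      t₁ * ((box 3 m).card : ℝ) ≤ ((((box 3 m).filter fun v => ω ∈ openConnIn (↑(box 3 m) : Set (Site 3)) 0 v).card : ℕ) : ℝ) ∧
      ((((box 3 (m + 1)).filter fun v => ω ∈ openConnIn (↑(box 3 (m + 1)) : Set (Site 3)) 0 v).card : ℕ) : ℝ) <
        t₁ * ((box 3 (m + 1)).card : ℝ) := by
  simp only [not_forall, not_le] at hfail
  have hex : ∃ m : ℕ, N ≤ m ∧ ((((box 3 m).filter fun v => ω ∈ openConnIn (↑(box 3 m) : Set (Site 3)) 0 v).card : ℕ) : ℝ) <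
      t₁ * ((box 3 m).card : ℝ) := by
    obtain ⟨m, hm, hlt⟩ := hfail
    exact ⟨m, hm, hlt⟩
  have hP := Nat.find_spec hex
  have hNlt : N < Nat.find hex := by
    rcases hP.1.eq_or_lt with h | h
    · exfalso
      rw [← h] at hP
      have : t₁ * ((box 3 N).card : ℝ) ≤ t * ((box 3 N).card : ℝ) := mul_le_mul_of_nonneg_right ht (Nat.cast_nonneg _)
      linarith [hP.2]
    · exact h
  have hmin := Nat.find_min hex (show Nat.find hex - 1 < Nat.find hex by omega)
  rw [not_and, not_lt] at hmin
  refine ⟨Nat.find hex - 1, by omega, hmin (by omega), ?_⟩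
  rw [show Nat.find hex - 1 + 1 = Nat.find hex by omega]
  exact hP.2

/-- **The bad events decay like a Gaussian in the scale** (`p < 1`): with `L = −log(1 − p)` and the droplet bound at
`A = 2(324 L + 2)`, `δ = t₁/2`, at scale `m + 1` (`m ≥ 4`), `P_p(Bad_m) ≤ exp(−2 t₁ (m+1)²)`. [cite: DiskinEtAl2026, §7] -/
theorem real_bad_le_exp (p : unitInterval) (hp : (p : ℝ) < 1) {t₁ : ℝ} (ht₁ : 0 ≤ t₁) {m : ℕ} (hm : 4 ≤ m)
    (hdrop : (bondPercolation (zdGraph 3) p).real {ω : BondConfig (Site 3) | openCluster ω (0 : Site 3) ⊆ ↑(box 3 (m + 1)) ∧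
        t₁ / 2 * ((box 3 (m + 1)).card : ℝ) ≤ ((openCluster ω (0 : Site 3)).ncard : ℝ)}
      ≤ Real.exp (-(2 * (324 * -Real.log (1 - (p : ℝ)) + 2) * (t₁ / 2) * ((m + 1 : ℕ) : ℝ) ^ 2))) :
    (bondPercolation (zdGraph 3) p).real {ω : BondConfig (Site 3) |
        t₁ * ((box 3 m).card : ℝ) ≤ ((((box 3 m).filter fun v => ω ∈ openConnIn (↑(box 3 m) : Set (Site 3)) 0 v).card : ℕ) : ℝ) ∧
        ((((box 3 (m + 1)).filter fun v => ω ∈ openConnIn (↑(box 3 (m + 1)) : Set (Site 3)) 0 v).card : ℕ) : ℝ) <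
          t₁ * ((box 3 (m + 1)).card : ℝ)}
      ≤ Real.exp (-(2 * t₁ * ((m : ℝ) + 1) ^ 2)) := by
  set L : ℝ := -Real.log (1 - (p : ℝ)) with hL
  have hq : 0 < 1 - (p : ℝ) := sub_pos.2 hp
  have hL0 : 0 ≤ L := by rw [hL, neg_nonneg]; exact Real.log_nonpos hq.le (by linarith [p.2.1])
  have hfe := real_bad_le_droplet p ht₁ hm
  set k : ℕ := ⌊6 * t₁ * (((box 3 (m + 1)).card : ℝ) - (box 3 m).card)⌋₊ with hk
  -- `k ≤ 324 t₁ (m+1)²`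
  have hΔ : (((box 3 (m + 1)).card : ℝ) - (box 3 m).card) ≤ 54 * ((m : ℝ) + 1) ^ 2 := by
    rw [card_box, card_box]; push_cast; nlinarith [sq_nonneg (m : ℝ), Nat.cast_nonneg (α := ℝ) m]
  have hΔ0 : 0 ≤ (((box 3 (m + 1)).card : ℝ) - (box 3 m).card) := by
    rw [sub_nonneg]; exact_mod_cast Finset.card_le_card (box_mono 3 (Nat.le_succ m))
  have hkle : (k : ℝ) ≤ 324 * t₁ * ((m : ℝ) + 1) ^ 2 := by
    refine le_trans (Nat.floor_le (by positivity)) ?_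
    nlinarith
  -- `(1-p)^k = exp(-k L) ≥ exp(-324 t₁ (m+1)² L)`
  have hpow : Real.exp (-(324 * t₁ * ((m : ℝ) + 1) ^ 2 * L)) ≤ (1 - (p : ℝ)) ^ k := by
    rw [← Real.exp_log (pow_pos hq k), Real.exp_le_exp, Real.log_pow, hL]
    have := Real.log_nonpos hq.le (by linarith [p.2.1])
    nlinarith
  have hm1 : ((m + 1 : ℕ) : ℝ) = (m : ℝ) + 1 := by push_cast; ring
  rw [hm1] at hdrop
  have hE0 : 0 < Real.exp (-(324 * t₁ * ((m : ℝ) + 1) ^ 2 * L)) := Real.exp_pos _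
  have key : Real.exp (-(324 * t₁ * ((m : ℝ) + 1) ^ 2 * L)) *
      (bondPercolation (zdGraph 3) p).real {ω : BondConfig (Site 3) |
        t₁ * ((box 3 m).card : ℝ) ≤ ((((box 3 m).filter fun v => ω ∈ openConnIn (↑(box 3 m) : Set (Site 3)) 0 v).card : ℕ) : ℝ) ∧
        ((((box 3 (m + 1)).filter fun v => ω ∈ openConnIn (↑(box 3 (m + 1)) : Set (Site 3)) 0 v).card : ℕ) : ℝ) <
          t₁ * ((box 3 (m + 1)).card : ℝ)}
      ≤ Real.exp (-(2 * (324 * L + 2) * (t₁ / 2) * ((m : ℝ) + 1) ^ 2)) :=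
    le_trans (le_trans (mul_le_mul_of_nonneg_right hpow measureReal_nonneg) hfe) hdrop
  have hexp : Real.exp (-(2 * (324 * L + 2) * (t₁ / 2) * ((m : ℝ) + 1) ^ 2)) =
      Real.exp (-(324 * t₁ * ((m : ℝ) + 1) ^ 2 * L)) * Real.exp (-(2 * t₁ * ((m : ℝ) + 1) ^ 2)) := by
    rw [← Real.exp_add]; congr 1; ring
  rw [hexp] at key
  exact le_of_mul_le_mul_left key hE0

/-- **Gaussian tail sum**: `Σ_{m ≥ N} exp(−2t₁(m+1)²) ≤ exp(−(t₁/2) N²)` for large `N`. [folklore] -/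
theorem tail_sum_le {t₁ : ℝ} (ht₁ : 0 < t₁) : ∃ N₁ : ℕ, ∀ N : ℕ, N₁ ≤ N →
    Summable (fun m : ℕ => if N ≤ m then Real.exp (-(2 * t₁ * ((m : ℝ) + 1) ^ 2)) else 0) ∧
    ∑' m : ℕ, (if N ≤ m then Real.exp (-(2 * t₁ * ((m : ℝ) + 1) ^ 2)) else 0) ≤ Real.exp (-(t₁ / 2 * (N : ℝ) ^ 2)) := by
  set r : ℝ := Real.exp (-t₁) with hr
  have hr0 : 0 ≤ r := (Real.exp_pos _).le
  have hr1 : r < 1 := by rw [hr, ← Real.exp_zero]; exact Real.exp_lt_exp.2 (by linarith)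
  set S₀ : ℝ := r * (1 - r)⁻¹ with hS₀
  have hS₀0 : 0 ≤ S₀ := mul_nonneg hr0 (inv_nonneg.2 (by linarith))
  have hgeom : HasSum (fun m : ℕ => r * r ^ m) S₀ := (hasSum_geometric_of_lt_one hr0 hr1).mul_left r
  obtain ⟨N₁, hN₁⟩ : ∃ N₁ : ℕ, ∀ N : ℕ, N₁ ≤ N → S₀ ≤ Real.exp (t₁ / 2 * (N : ℝ) ^ 2) := by
    obtain ⟨K, hK⟩ := exists_nat_ge (2 * Real.log (max S₀ 1) / t₁)
    refine ⟨max K 1, fun N hN => ?_⟩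
    have hN1 : (1 : ℝ) ≤ N := by exact_mod_cast le_trans (le_max_right K 1) hN
    have hNK : (K : ℝ) ≤ N := by exact_mod_cast le_trans (le_max_left K 1) hN
    have hlog : Real.log (max S₀ 1) ≤ t₁ / 2 * (N : ℝ) ^ 2 := by
      have h1 : 2 * Real.log (max S₀ 1) / t₁ * t₁ = 2 * Real.log (max S₀ 1) := div_mul_cancel₀ _ ht₁.ne'
      have e1 : 2 * Real.log (max S₀ 1) ≤ (N : ℝ) * t₁ := by
        rw [← h1]; exact mul_le_mul_of_nonneg_right (hK.trans hNK) ht₁.le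
      have e2 : (N : ℝ) * t₁ ≤ (N : ℝ) ^ 2 * t₁ := by
        refine mul_le_mul_of_nonneg_right ?_ ht₁.le
        nlinarith
      linarith
    calc S₀ ≤ max S₀ 1 := le_max_left _ _
      _ = Real.exp (Real.log (max S₀ 1)) := (Real.exp_log (lt_of_lt_of_le one_pos (le_max_right _ _))).symm
      _ ≤ Real.exp (t₁ / 2 * (N : ℝ) ^ 2) := Real.exp_le_exp.2 hlog
  refine ⟨N₁, fun N hN => ?_⟩
  have hterm : ∀ m : ℕ, (if N ≤ m then Real.exp (-(2 * t₁ * ((m : ℝ) + 1) ^ 2)) else 0) ≤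
      Real.exp (-(t₁ * (N : ℝ) ^ 2)) * (r * r ^ m) := by
    intro m
    split_ifs with h
    · rw [hr, ← Real.exp_nat_mul, ← Real.exp_add, ← Real.exp_add, Real.exp_le_exp]
      have hNm : (N : ℝ) ≤ m := by exact_mod_cast h
      have hm0 : (0 : ℝ) ≤ m := Nat.cast_nonneg m
      have hN0 : (0 : ℝ) ≤ N := Nat.cast_nonneg N
      have e1 : t₁ * (N : ℝ) ^ 2 ≤ t₁ * ((m : ℝ) + 1) ^ 2 :=
        mul_le_mul_of_nonneg_left (by nlinarith) ht₁.le
      have e2 : t₁ * ((m : ℝ) + 1) ≤ t₁ * ((m : ℝ) + 1) ^ 2 :=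
        mul_le_mul_of_nonneg_left (by nlinarith) ht₁.le
      nlinarith
    · exact mul_nonneg (Real.exp_pos _).le (mul_nonneg hr0 (pow_nonneg hr0 _))
  have hnn : ∀ m : ℕ, 0 ≤ (if N ≤ m then Real.exp (-(2 * t₁ * ((m : ℝ) + 1) ^ 2)) else 0) := fun m => by
    split_ifs
    · exact (Real.exp_pos _).le
    · exact le_rfl
  have hsum2 : HasSum (fun m : ℕ => Real.exp (-(t₁ * (N : ℝ) ^ 2)) * (r * r ^ m)) (Real.exp (-(t₁ * (N : ℝ) ^ 2)) * S₀) :=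
    hgeom.mul_left _
  have hsumm : Summable (fun m : ℕ => if N ≤ m then Real.exp (-(2 * t₁ * ((m : ℝ) + 1) ^ 2)) else 0) :=
    Summable.of_nonneg_of_le hnn hterm hsum2.summable
  refine ⟨hsumm, ?_⟩
  calc ∑' m : ℕ, (if N ≤ m then Real.exp (-(2 * t₁ * ((m : ℝ) + 1) ^ 2)) else 0)
      ≤ ∑' m : ℕ, Real.exp (-(t₁ * (N : ℝ) ^ 2)) * (r * r ^ m) := hsumm.tsum_le_tsum hterm hsum2.summable
    _ = Real.exp (-(t₁ * (N : ℝ) ^ 2)) * S₀ := hsum2.tsum_eq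
    _ ≤ Real.exp (-(t₁ * (N : ℝ) ^ 2)) * Real.exp (t₁ / 2 * (N : ℝ) ^ 2) :=
        mul_le_mul_of_nonneg_left (hN₁ N hN) (Real.exp_pos _).le
    _ = Real.exp (-(t₁ / 2 * (N : ℝ) ^ 2)) := by rw [← Real.exp_add]; congr 1; ring

/-- **At `p = 1` the bad events are null**: almost surely every lattice edge of `B_{m+1}` is open, so (boxes being connected)
`C^{m+1} = B_{m+1}` has density `1 ≥ t₁`. [folklore] -/
theorem real_bad_eq_zero_one (p : unitInterval) (hp : (p : ℝ) = 1) {t₁ : ℝ} (ht₁ : t₁ ≤ 1) (m : ℕ) :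
    (bondPercolation (zdGraph 3) p).real {ω : BondConfig (Site 3) |
        t₁ * ((box 3 m).card : ℝ) ≤ ((((box 3 m).filter fun v => ω ∈ openConnIn (↑(box 3 m) : Set (Site 3)) 0 v).card : ℕ) : ℝ) ∧
        ((((box 3 (m + 1)).filter fun v => ω ∈ openConnIn (↑(box 3 (m + 1)) : Set (Site 3)) 0 v).card : ℕ) : ℝ) <
          t₁ * ((box 3 (m + 1)).card : ℝ)} = 0 := by
  set E : Finset (Sym2 (Site 3)) := edgesIn (zdGraph 3) (box 3 (m + 1)) with hE
  have hEsub : (↑E : Set (Sym2 (Site 3))) ⊆ (zdGraph 3).edgeSet := fun e he => (mem_edgesIn_iff.1 (Finset.mem_coe.1 he)).1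
  -- if all edges of `E` are open, every vertex of the box is joined to `0` inside it
  have hfull : ∀ ω : BondConfig (Site 3), (↑E : Set (Sym2 (Site 3))) ⊆ ω →
      ((box 3 (m + 1)).filter fun v => ω ∈ openConnIn (↑(box 3 (m + 1)) : Set (Site 3)) 0 v) = box 3 (m + 1) := by
    intro ω hω
    refine Finset.filter_true_of_mem fun v hv => ?_
    refine DCT16.mem_openConnIn_of_pathIn (DCT16.pathIn_congrGraph (fun a b ha hb hab => ?_)
      (Crossing.pathIn_box_zero (d := 3) (by norm_num) (m + 1) hv))
    rw [openGraph_adj]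
    refine ⟨hω (Finset.mem_coe.2 ?_), hab.ne⟩
    rw [hE, mem_edgesIn_iff]
    refine ⟨(SimpleGraph.mem_edgeSet _).2 hab, fun x hx => ?_⟩
    rcases Sym2.mem_iff.1 hx with rfl | rfl
    · exact Finset.mem_coe.1 ha
    · exact Finset.mem_coe.1 hb
  have hsub : {ω : BondConfig (Site 3) |
        t₁ * ((box 3 m).card : ℝ) ≤ ((((box 3 m).filter fun v => ω ∈ openConnIn (↑(box 3 m) : Set (Site 3)) 0 v).card : ℕ) : ℝ) ∧
        ((((box 3 (m + 1)).filter fun v => ω ∈ openConnIn (↑(box 3 (m + 1)) : Set (Site 3)) 0 v).card : ℕ) : ℝ) <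
          t₁ * ((box 3 (m + 1)).card : ℝ)} ⊆ {ω | (↑E : Set (Sym2 (Site 3))) ⊆ ω}ᶜ := by
    rintro ω ⟨-, h2⟩ hω
    rw [Set.mem_setOf_eq] at hω
    rw [hfull ω hω] at h2
    have : ((box 3 (m + 1)).card : ℝ) * t₁ ≤ (box 3 (m + 1)).card * 1 := mul_le_mul_of_nonneg_left ht₁ (Nat.cast_nonneg _)
    linarith
  refine le_antisymm (le_trans (measureReal_mono hsub) ?_) measureReal_nonneg
  have hopen : (bondPercolation (zdGraph 3) p).real {ω | (↑E : Set (Sym2 (Site 3))) ⊆ ω} = 1 := by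
    rw [bondPercolation_real_setOf_subset (zdGraph 3) p E hEsub, hp, one_pow]
  rw [measureReal_compl (measurableSet_setOf_subset E.countable_toSet), probReal_univ, hopen, sub_self]

/-- **`PercEventualDensity.MassPropagation` (stmt-CriticalPhenomena-17922): mass propagation at one vertex.**
[cite: DiskinEtAl2026, §7] -/
theorem massPropagation_proof : Summit.CriticalPhenomena.PercolationContinuityZ3.Theses.PercEventualDensity.MassPropagation := by
  unfold Summit.CriticalPhenomena.PercolationContinuityZ3.Theses.PercEventualDensity.MassPropagation
  intro C p hdrop t ht
  -- the in-box cluster set as a filtered finset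
  have hC : ∀ (ω : BondConfig (Site 3)) (m : ℕ), ((C ω m).ncard : ℝ) =
      ((((box 3 m).filter fun v => ω ∈ openConnIn (↑(box 3 m) : Set (Site 3)) 0 v).card : ℕ) : ℝ) := by
    intro ω m
    have : C ω m = ↑((box 3 m).filter fun v => ω ∈ openConnIn (↑(box 3 m) : Set (Site 3)) 0 v) := by
      ext v; simp [C]
    rw [this, Set.ncard_coe_finset]
  by_cases hp : (p : ℝ) < 1
  · -- constants
    set L : ℝ := -Real.log (1 - (p : ℝ)) with hL
    have hq : 0 < 1 - (p : ℝ) := sub_pos.2 hp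
    have hL0 : 0 ≤ L := by rw [hL, neg_nonneg]; exact Real.log_nonpos hq.le (by linarith [p.2.1])
    have hA : 0 < 2 * (324 * L + 2) := by positivity
    obtain ⟨δ₀, hδ₀, hδ⟩ := hdrop (2 * (324 * L + 2)) hA
    set t₁ : ℝ := min t (2 * δ₀) with ht₁
    have ht₁0 : 0 < t₁ := lt_min ht (by linarith)
    have ht₁t : t₁ ≤ t := min_le_left _ _
    obtain ⟨m₀, hm₀⟩ := hδ (t₁ / 2) (by linarith) (by rw [ht₁]; linarith [min_le_right t (2 * δ₀)])
    obtain ⟨N₁, hN₁⟩ := tail_sum_le ht₁0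
    refine ⟨t₁, ht₁0, ht₁t, t₁ / 2, by linarith, max (max m₀ 4) N₁, fun N hN => ?_⟩
    have hNm₀ : m₀ ≤ N := le_trans (le_trans (le_max_left _ _) (le_max_left _ _)) hN
    have hN4 : 4 ≤ N := le_trans (le_trans (le_max_right _ _) (le_max_left _ _)) hN
    have hNN₁ : N₁ ≤ N := le_trans (le_max_right _ _) hN
    obtain ⟨hsumm, htail⟩ := hN₁ N hNN₁
    -- the event lies in the union of the bad events `m ≥ N`
    have hcov : {ω : BondConfig (Site 3) | t * ((box 3 N).card : ℝ) ≤ ((C ω N).ncard : ℝ) ∧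
        ¬ ∀ m : ℕ, N ≤ m → t₁ * ((box 3 m).card : ℝ) ≤ ((C ω m).ncard : ℝ)} ⊆
        ⋃ m : ℕ, {ω : BondConfig (Site 3) | N ≤ m ∧
          (t₁ * ((box 3 m).card : ℝ) ≤ ((((box 3 m).filter fun v => ω ∈ openConnIn (↑(box 3 m) : Set (Site 3)) 0 v).card : ℕ) : ℝ) ∧
          ((((box 3 (m + 1)).filter fun v => ω ∈ openConnIn (↑(box 3 (m + 1)) : Set (Site 3)) 0 v).card : ℕ) : ℝ) <
            t₁ * ((box 3 (m + 1)).card : ℝ))} := by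
      rintro ω ⟨h1, h2⟩
      simp only [hC] at h1 h2
      obtain ⟨m, hm, hb1, hb2⟩ := bad_cover ht₁t h1 h2
      exact Set.mem_iUnion.2 ⟨m, hm, hb1, hb2⟩
    -- each bad event: Gaussian bound
    have hbad : ∀ m : ℕ, (bondPercolation (zdGraph 3) p) {ω : BondConfig (Site 3) | N ≤ m ∧
          (t₁ * ((box 3 m).card : ℝ) ≤ ((((box 3 m).filter fun v => ω ∈ openConnIn (↑(box 3 m) : Set (Site 3)) 0 v).card : ℕ) : ℝ) ∧
          ((((box 3 (m + 1)).filter fun v => ω ∈ openConnIn (↑(box 3 (m + 1)) : Set (Site 3)) 0 v).card : ℕ) : ℝ) <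
            t₁ * ((box 3 (m + 1)).card : ℝ))} ≤
        ENNReal.ofReal (if N ≤ m then Real.exp (-(2 * t₁ * ((m : ℝ) + 1) ^ 2)) else 0) := by
      intro m
      by_cases hNm : N ≤ m
      · rw [if_pos hNm, ← ofReal_measureReal (measure_ne_top _ _)]
        refine ENNReal.ofReal_le_ofReal (le_trans (measureReal_mono (fun ω hω => hω.2)) ?_)
        have hm4 : 4 ≤ m := le_trans hN4 hNm
        refine real_bad_le_exp p hp ht₁0.le hm4 ?_
        have h := hm₀ (m + 1) (by omega)
        refine le_trans h (le_of_eq ?_)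
        congr 1
      · rw [if_neg hNm]
        have : {ω : BondConfig (Site 3) | N ≤ m ∧
          (t₁ * ((box 3 m).card : ℝ) ≤ ((((box 3 m).filter fun v => ω ∈ openConnIn (↑(box 3 m) : Set (Site 3)) 0 v).card : ℕ) : ℝ) ∧
          ((((box 3 (m + 1)).filter fun v => ω ∈ openConnIn (↑(box 3 (m + 1)) : Set (Site 3)) 0 v).card : ℕ) : ℝ) <
            t₁ * ((box 3 (m + 1)).card : ℝ))} = ∅ := by
          ext ω; simp only [Set.mem_setOf_eq, Set.mem_empty_iff_false, iff_false, not_and]; exact fun h => absurd h hNm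
        rw [this, measure_empty, ENNReal.ofReal_zero]
    have hmain : (bondPercolation (zdGraph 3) p) {ω : BondConfig (Site 3) | t * ((box 3 N).card : ℝ) ≤ ((C ω N).ncard : ℝ) ∧
        ¬ ∀ m : ℕ, N ≤ m → t₁ * ((box 3 m).card : ℝ) ≤ ((C ω m).ncard : ℝ)} ≤
        ENNReal.ofReal (Real.exp (-(t₁ / 2 * (N : ℝ) ^ 2))) := by
      refine le_trans (measure_mono hcov) (le_trans (measure_iUnion_le _) ?_)
      refine le_trans (ENNReal.tsum_le_tsum hbad) ?_
      rw [← ENNReal.ofReal_tsum_of_nonneg (fun m => ?_) hsumm]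
      · exact ENNReal.ofReal_le_ofReal htail
      · split_ifs
        · exact (Real.exp_pos _).le
        · exact le_rfl
    have h := ENNReal.toReal_mono ENNReal.ofReal_ne_top hmain
    rw [ENNReal.toReal_ofReal (Real.exp_pos _).le] at h
    rw [measureReal_def]
    exact h
  · -- `p = 1`: the bad events are null
    have hp1 : (p : ℝ) = 1 := le_antisymm p.2.2 (not_lt.1 hp)
    refine ⟨min t 1, lt_min ht one_pos, min_le_left _ _, 1, one_pos, 0, fun N _ => ?_⟩
    have hcov : {ω : BondConfig (Site 3) | t * ((box 3 N).card : ℝ) ≤ ((C ω N).ncard : ℝ) ∧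
        ¬ ∀ m : ℕ, N ≤ m → min t 1 * ((box 3 m).card : ℝ) ≤ ((C ω m).ncard : ℝ)} ⊆
        ⋃ m : ℕ, {ω : BondConfig (Site 3) |
          (min t 1 * ((box 3 m).card : ℝ) ≤ ((((box 3 m).filter fun v => ω ∈ openConnIn (↑(box 3 m) : Set (Site 3)) 0 v).card : ℕ) : ℝ) ∧
          ((((box 3 (m + 1)).filter fun v => ω ∈ openConnIn (↑(box 3 (m + 1)) : Set (Site 3)) 0 v).card : ℕ) : ℝ) <
            min t 1 * ((box 3 (m + 1)).card : ℝ))} := by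
      rintro ω ⟨h1, h2⟩
      simp only [hC] at h1 h2
      obtain ⟨m, -, hb1, hb2⟩ := bad_cover (min_le_left t 1) h1 h2
      exact Set.mem_iUnion.2 ⟨m, hb1, hb2⟩
    have hzero : (bondPercolation (zdGraph 3) p) {ω : BondConfig (Site 3) | t * ((box 3 N).card : ℝ) ≤ ((C ω N).ncard : ℝ) ∧
        ¬ ∀ m : ℕ, N ≤ m → min t 1 * ((box 3 m).card : ℝ) ≤ ((C ω m).ncard : ℝ)} = 0 := by
      refine le_antisymm (le_trans (measure_mono hcov) (le_trans (measure_iUnion_le _) ?_)) bot_le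
      rw [ENNReal.tsum_eq_zero.2 fun m => ?_]
      exact (measureReal_eq_zero_iff (measure_ne_top _ _)).1 (real_bad_eq_zero_one p hp1 (min_le_right t 1) m)
    rw [measureReal_def, hzero, ENNReal.toReal_zero]
    exact (Real.exp_pos _).le

end MassPropagation

end Summit.CriticalPhenomena.PercolationContinuityZ3.Theorems

end
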